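import Mathlib.Topology.Order.ProjIcc
import Literature.Probability.Percolation.SelfRefinementMeasure
import Literature.Probability.Percolation.KohlerSchindlerTassionRSW
import Literature.Probability.Percolation.ProdBernoulliRusso

/-!
# Stub `stub_phaseDiagramLandmarksA` of line `finite-size-envelope` (crux `CriticalPathRSW`)

Support file for item `stmt-CriticalPhenomena-10267` (route `CardySelfRefinement`, crux r3,
line finite-size-envelope): the regularity half of the landmarks of the finite-size phase diagram
of the self-refinement measures `M_k(ρ, c) = selfRefinementMeasure k ρ c`.

* **Continuity.** For every box `[-m, m] × [-n, n]` the crossing probability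
  `(ρ, c) ↦ M_k(ρ, c)(𝓒(m, n))` (`KST2023.crossing m n`) is continuous on `ℝ²`: the pulled-back
  event `(refinementConfig k)⁻¹' 𝓒(m, n)` is determined by the finitely many coins read by the edges
  of the box (`PlanarDuality.determinedBy_openCrossing`; each edge reads at most three coins), so by
  the cylinder formula `RussoPath.prodBernoulli_real_eq_sum_powerset` the probability is a polynomial
  in the coin biases `1/2`, `projIcc c`, `projIcc ρ`, which are continuous in `(ρ, c)`
  (`continuous_projIcc`).
* **Top edge.** At `c = 1` every interior edge is almost surely open (`prodBernoulli_ae_mem`); for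
  `k ≥ 2` the row `y = 1` of the box `[-m, m] × [-n, n]` (`n ≥ 1`) consists of interior horizontal
  edges (axial iff `k ∣ 1`), so it is an almost sure open left-right crossing and
  `M_k(ρ, 1)(𝓒(m, n)) = 1`.

The registered stub `stub_phaseDiagramLandmarksA` (namespace
`Summit.CriticalPhenomena.CardyFormulaZ2.Cruxes.CriticalPathRSW.FiniteSizeEnvelope`) packages the two
facts for `k = 2, 3` and the certificate boxes `[-kn, kn] × [-3kn, 3kn]`, `[-3kn, 3kn] × [-kn, kn]`.

References: Grimmett 1999, §2.2 (cylinder events), §2.4 (cylinder polynomials); Beffara 2008,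
§5.1 (mixed percolation).
-/

noncomputable section

namespace Summit.CriticalPhenomena.CardyFormulaZ2.Cruxes.CriticalPathRSW.FiniteSizeEnvelope

open Set MeasureTheory Filter Topology
open Literature.Probability.LatticeModels Literature.Probability.Percolation

namespace LandmarksA

/-! ### The crossing event is a cylinder event of the coins -/

/-- The lattice box `[-m, m] × [-n, n]` is finite. -/
theorem box_finite (m n : ℕ) : (KST2023.box m n).Finite := by
  refine (Set.finite_Icc (![-(m : ℤ), -(n : ℤ)] : Site 2) ![(m : ℤ), (n : ℤ)]).subset fun x hx => ?_
  rw [KST2023.mem_box, abs_le, abs_le] at hx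
  obtain ⟨⟨h0, h0'⟩, h1, h1'⟩ := hx
  refine ⟨fun i => ?_, fun i => ?_⟩ <;> fin_cases i <;> simpa

/-- The crossing event `𝓒(m, n)` as an open crossing of a `Finset` region. -/
theorem crossing_eq (m n : ℕ) :
    KST2023.crossing m n = openCrossing (↑(box_finite m n).toFinset)
      {x | x ∈ KST2023.box m n ∧ x 0 = -(m : ℤ)} {x | x ∈ KST2023.box m n ∧ x 0 = m} := by
  rw [Set.Finite.coe_toFinset]
  rfl

/-- The crossing event `𝓒(m, n)` is determined by the pairs of vertices of the box
(`PlanarDuality.determinedBy_openCrossing`). -/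
theorem determinedBy_crossing (m n : ℕ) :
    DeterminedBy (KST2023.crossing m n) ↑((box_finite m n).toFinset.sym2) := by
  rw [crossing_eq]
  exact PlanarDuality.determinedBy_openCrossing _ _ _

/-- The opening rule of an edge only reads its three coins (own, shared, selector). -/
theorem refinementOpen_congr {k : ℕ} {S S' : Set (Site 2 × Fin 2 × Fin 3)} {e : Site 2 × Fin 2}
    (h0 : (e.1, e.2, (0 : Fin 3)) ∈ S ↔ (e.1, e.2, (0 : Fin 3)) ∈ S')
    (h1 : (tupleBase k e, e.2, (1 : Fin 3)) ∈ S ↔ (tupleBase k e, e.2, (1 : Fin 3)) ∈ S')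
    (h2 : (tupleBase k e, e.2, (2 : Fin 3)) ∈ S ↔ (tupleBase k e, e.2, (2 : Fin 3)) ∈ S') :
    RefinementOpen k S e ↔ RefinementOpen k S' e := by
  by_cases hax : IsAxialEdge k e
  · rw [refinementOpen_of_isAxialEdge S hax, refinementOpen_of_isAxialEdge S' hax, h0, h1, h2]
  · rw [refinementOpen_of_not_isAxialEdge S hax, refinementOpen_of_not_isAxialEdge S' hax, h0]

-- adapted from `Theorems/CardySelfRefinementRussoDriftPolynomial.lean` (`determinedBy_preimage_Aloc`)
/-- **Pull-back to the coins.** An event of bond configurations determined by the pairs of vertices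
of a finite set `F` pulls back under the configuration map `refinementConfig k` to an event of the
coins determined by a finite set of coins (the at most three coins read by each edge based in `F`). -/
theorem exists_determinedBy_preimage (k : ℕ) {A : Set (BondConfig (Site 2))} {F : Finset (Site 2)}
    (hA : DeterminedBy A ↑F.sym2) :
    ∃ K : Finset (Site 2 × Fin 2 × Fin 3), DeterminedBy (refinementConfig k ⁻¹' A) ↑K := by
  classical
  let K : Finset (Site 2 × Fin 2 × Fin 3) := (F ×ˢ (Finset.univ : Finset (Fin 2))).biUnion fun e =>
    {(e.1, e.2, (0 : Fin 3)), (tupleBase k e, e.2, (1 : Fin 3)), (tupleBase k e, e.2, (2 : Fin 3))}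
  refine ⟨K, ?_⟩
  rw [determinedBy_iff] at hA ⊢
  intro S S' hSS'
  have hagree : ∀ i ∈ K, (i ∈ S ↔ i ∈ S') := fun i hi =>
    ⟨fun h => ((Set.ext_iff.1 hSS' i).1 ⟨h, hi⟩).1, fun h => ((Set.ext_iff.1 hSS' i).2 ⟨h, hi⟩).1⟩
  -- an edge based at a vertex of `F` reads coins of `K` only
  have key : ∀ (v : Site 2) (d : Fin 2), v ∈ F →
      (RefinementOpen k S (v, d) ↔ RefinementOpen k S' (v, d)) := by
    intro v d hv
    have hK : ∀ i ∈ ({((v, d).1, (v, d).2, (0 : Fin 3)), (tupleBase k (v, d), (v, d).2, (1 : Fin 3)),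
        (tupleBase k (v, d), (v, d).2, (2 : Fin 3))} : Finset (Site 2 × Fin 2 × Fin 3)), (i ∈ S ↔ i ∈ S') :=
      fun i hi => hagree i (Finset.mem_biUnion.2 ⟨(v, d), Finset.mem_product.2 ⟨hv, Finset.mem_univ _⟩, hi⟩)
    exact refinementOpen_congr (hK _ (by simp)) (hK _ (by simp)) (hK _ (by simp))
  simp only [Set.mem_preimage]
  refine hA _ _ (Set.ext fun x => ?_)
  simp only [Set.mem_inter_iff]
  suffices h : x ∈ (↑F.sym2 : Set (Sym2 (Site 2))) →
      (x ∈ refinementConfig k S ↔ x ∈ refinementConfig k S') by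
    exact ⟨fun hx => ⟨(h hx.2).1 hx.1, hx.2⟩, fun hx => ⟨(h hx.2).2 hx.1, hx.2⟩⟩
  intro hx
  have hvF : ∀ (v : Site 2) (d : Fin 2), x = s(v, v + (if d = 0 then ![1, 0] else ![0, 1])) → v ∈ F := by
    intro v d hxe
    have h := Finset.mem_sym2_iff.1 (Finset.mem_coe.1 hx) v
    rw [hxe] at h
    exact h (Sym2.mem_mk_left _ _)
  rw [mem_refinementConfig_iff, mem_refinementConfig_iff]
  constructor
  · rintro ⟨v, d, hxe, hopen⟩
    exact ⟨v, d, hxe, (key v d (hvF v d hxe)).1 hopen⟩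
  · rintro ⟨v, d, hxe, hopen⟩
    exact ⟨v, d, hxe, (key v d (hvF v d hxe)).2 hopen⟩

/-! ### Continuity in the parameter point -/

/-- Every coin bias of `M_k(ρ, c)` (`1/2`, `projIcc c` or `projIcc ρ`) is continuous in `(ρ, c)`. -/
theorem continuous_refinementParam (k : ℕ) (i : Site 2 × Fin 2 × Fin 3) :
    Continuous fun q : ℝ × ℝ => refinementParam k q.1 q.2 i := by
  unfold refinementParam
  split_ifs
  exacts [continuous_const, continuous_projIcc.comp continuous_snd, continuous_const,
    continuous_projIcc.comp continuous_fst]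

/-- **Cylinder polynomials are continuous.** If the pull-back of the measurable event `A` to the
coins is determined by a finite set of coins, then `(ρ, c) ↦ M_k(ρ, c)(A)` is continuous on `ℝ²`
(a finite sum of finite products of coin biases, `RussoPath.prodBernoulli_real_eq_sum_powerset`). -/
theorem continuous_real_of_determinedBy (k : ℕ) {A : Set (BondConfig (Site 2))}
    (hAm : MeasurableSet A) {K : Finset (Site 2 × Fin 2 × Fin 3)}
    (hK : DeterminedBy (refinementConfig k ⁻¹' A) ↑K) :
    Continuous fun q : ℝ × ℝ => (selfRefinementMeasure k q.1 q.2).real A := by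
  classical
  have h : (fun q : ℝ × ℝ => (selfRefinementMeasure k q.1 q.2).real A) = fun q =>
      (prodBernoulli (refinementParam k q.1 q.2)).real (refinementConfig k ⁻¹' A) :=
    funext fun q => selfRefinementMeasure_real_apply k q.1 q.2 hAm
  rw [h]
  simp_rw [RussoPath.prodBernoulli_real_eq_sum_powerset hK]
  refine continuous_finsetSum _ fun S _ => ?_
  split_ifs
  · refine continuous_finsetProd _ fun i _ => ?_
    split_ifs
    · exact (continuous_refinementParam k i).subtype_val
    · exact continuous_const.sub (continuous_refinementParam k i).subtype_val
  · exact continuous_const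

/-- **Crossing probabilities of `M_k(ρ, c)` are continuous in `(ρ, c) ∈ ℝ²`.** -/
theorem continuous_real_crossing (k m n : ℕ) :
    Continuous fun q : ℝ × ℝ => (selfRefinementMeasure k q.1 q.2).real (KST2023.crossing m n) := by
  obtain ⟨K, hK⟩ := exists_determinedBy_preimage k (determinedBy_crossing m n)
  exact continuous_real_of_determinedBy k (measurableSet_openCrossing_of_countable _ _ _) hK

/-! ### The top edge `c = 1` -/

/-- For `k ≥ 2` the horizontal edges of the row `y = 1` are interior (not axial). -/
theorem not_isAxialEdge_row {k : ℕ} (hk : 2 ≤ k) (t : ℤ) :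
    ¬ IsAxialEdge k ((![t, 1] : Site 2), (0 : Fin 2)) := by
  rw [isAxialEdge_zero_iff]
  intro h
  have h1 : (k : ℤ) ∣ 1 := by simpa using h
  have h2 : k ∣ 1 := by exact_mod_cast h1
  have h3 : k = 1 := Nat.dvd_one.1 h2
  omega

/-- If the own coins of the row `y = 1` are all on, every edge `((t, 1), (t + 1, 1))` is open
(`k ≥ 2`). -/
theorem row_edge_mem {k : ℕ} (hk : 2 ≤ k) {S : Set (Site 2 × Fin 2 × Fin 3)}
    (hS : ∀ t : ℤ, (((![t, 1] : Site 2), (0 : Fin 2), (0 : Fin 3)) : Site 2 × Fin 2 × Fin 3) ∈ S) (t : ℤ) :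
    s((![t, 1] : Site 2), ![t + 1, 1]) ∈ refinementConfig k S := by
  have he : cornerEdge ((![t, 1] : Site 2), (0 : Fin 2)) = s((![t, 1] : Site 2), ![t + 1, 1]) := by
    simp only [cornerEdge]
    congr 2
    funext i
    fin_cases i <;> simp
  rw [← he, cornerEdge_mem_refinementConfig_iff, refinementOpen_of_not_isAxialEdge S (not_isAxialEdge_row hk t)]
  exact hS t

/-- Points of the row `y = 1` with abscissa in `[-m, m]` lie in the box `[-m, m] × [-n, n]`, `n ≥ 1`. -/
theorem row_mem_box {m n : ℕ} (hn : 1 ≤ n) {t : ℤ} (h1 : -(m : ℤ) ≤ t) (h2 : t ≤ m) :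
    (![t, 1] : Site 2) ∈ KST2023.box m n := by
  rw [KST2023.mem_box]
  refine ⟨?_, ?_⟩
  · simpa using abs_le.2 ⟨h1, h2⟩
  · have : (1 : ℤ) ≤ n := by exact_mod_cast hn
    simpa using this

/-- **An open row is a crossing.** If the own coins of the row `y = 1` are all on, the
configuration has a left-right open crossing of `[-m, m] × [-n, n]` (`k ≥ 2`, `n ≥ 1`). -/
theorem refinementConfig_mem_crossing_of_row {k : ℕ} (hk : 2 ≤ k) {m n : ℕ} (hn : 1 ≤ n)
    {S : Set (Site 2 × Fin 2 × Fin 3)}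
    (hS : ∀ t : ℤ, (((![t, 1] : Site 2), (0 : Fin 2), (0 : Fin 3)) : Site 2 × Fin 2 × Fin 3) ∈ S) :
    refinementConfig k S ∈ KST2023.crossing m n := by
  have hreach : ∀ j : ℕ, (j : ℤ) ≤ 2 * m →
      refinementConfig k S ∈ openConnIn (KST2023.box m n) (![-(m : ℤ), 1] : Site 2) ![-(m : ℤ) + j, 1] := by
    intro j
    induction j with
    | zero =>
      intro _
      simp only [Nat.cast_zero, add_zero]
      exact openConnIn_refl (row_mem_box hn le_rfl (by omega))
    | succ j ih =>
      intro hj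
      push_cast at hj ⊢
      refine PlanarDuality.openConnIn_trans (ih (by omega)) ?_
      have hadj := row_edge_mem hk hS (-(m : ℤ) + j)
      rw [add_assoc] at hadj
      refine openConnIn_of_adj (row_mem_box hn (by omega) (by omega))
        (row_mem_box hn (by omega) (by omega)) hadj fun h => ?_
      have h0 := congr_fun h 0
      simp only [Matrix.cons_val_zero] at h0
      omega
  rw [KST2023.mem_crossing]
  refine ⟨![-(m : ℤ), 1], ⟨row_mem_box hn le_rfl (by omega), by simp⟩, ![(m : ℤ), 1],
    ⟨row_mem_box hn (by omega) le_rfl, by simp⟩, ?_⟩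
  have h := hreach (2 * m) (by push_cast; omega)
  have hm : (-(m : ℤ) + ((2 * m : ℕ) : ℤ)) = m := by push_cast; ring
  rwa [hm] at h

/-- At `c = 1` the own coins of the row `y = 1` are almost surely all on (`k ≥ 2`: the row is
interior, and an interior own coin has bias `projIcc 1 = 1`). -/
theorem ae_forall_row_mem {k : ℕ} (hk : 2 ≤ k) (ρ : ℝ) :
    ∀ᵐ S ∂prodBernoulli (refinementParam k ρ 1),
      ∀ t : ℤ, (((![t, 1] : Site 2), (0 : Fin 2), (0 : Fin 3)) : Site 2 × Fin 2 × Fin 3) ∈ S := by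
  have h : ∀ t : ℤ, ∀ᵐ S ∂prodBernoulli (refinementParam k ρ 1),
      (((![t, 1] : Site 2), (0 : Fin 2), (0 : Fin 3)) : Site 2 × Fin 2 × Fin 3) ∈ S := by
    intro t
    refine prodBernoulli_ae_mem _ ?_
    change refinementParam k ρ 1 ((((![t, 1] : Site 2), (0 : Fin 2)) : Site 2 × Fin 2).1,
      (((![t, 1] : Site 2), (0 : Fin 2)) : Site 2 × Fin 2).2, 0) = 1
    rw [refinementParam_apply_zero_of_not_isAxialEdge ρ 1 (not_isAxialEdge_row hk t),
      projIcc_unitInterval_one]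
  exact ae_all_iff.2 h

/-- **The top edge is supercritical-certified**: for `k ≥ 2`, `n ≥ 1` and every `ρ`, the
left-right crossing of `[-m, m] × [-n, n]` has `M_k(ρ, 1)`-probability `1`. -/
theorem real_crossing_top {k : ℕ} (hk : 2 ≤ k) (ρ : ℝ) (m : ℕ) {n : ℕ} (hn : 1 ≤ n) :
    (selfRefinementMeasure k ρ 1).real (KST2023.crossing m n) = 1 := by
  have hA : MeasurableSet (KST2023.crossing m n) := measurableSet_openCrossing_of_countable _ _ _
  have hae : ∀ᵐ S ∂prodBernoulli (refinementParam k ρ 1), S ∈ refinementConfig k ⁻¹' KST2023.crossing m n := by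
    filter_upwards [ae_forall_row_mem hk ρ] with S hS
    exact refinementConfig_mem_crossing_of_row hk hn hS
  rw [selfRefinementMeasure_real_apply k ρ 1 hA, measureReal_def,
    (mem_ae_iff_prob_eq_one (measurable_refinementConfig k hA)).1 hae, ENNReal.toReal_one]

end LandmarksA

/-- STUB 2a of line `finite-size-envelope` — **regularity of the finite-size phase diagram and the
top edge**: for `k = 2, 3` the certificate probabilities
`q ↦ M_k(q)(𝓒(kn, 3kn))`, `q ↦ M_k(q)(𝓒(3kn, kn))` are continuous on `ℝ²` (cylinder polynomials in
the clamped parameters), and on the top edge `c = 1` the hard-way crossing `𝓒(3kn, kn)` is almost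
sure for every `n ≥ 1` (the row `y = 1` consists of interior edges, open a.s. at `c = 1`). -/
theorem stub_phaseDiagramLandmarksA :
  ∀ k : ℕ, k = 2 ∨ k = 3 →
    (∀ n : ℕ, Continuous fun q : ℝ × ℝ =>
      (selfRefinementMeasure k q.1 q.2).real (KST2023.crossing (k * n) (3 * (k * n)))) ∧
    (∀ n : ℕ, Continuous fun q : ℝ × ℝ =>
      (selfRefinementMeasure k q.1 q.2).real (KST2023.crossing (3 * (k * n)) (k * n))) ∧
    (∀ n : ℕ, 1 ≤ n → ∀ ρ : ℝ,
      (selfRefinementMeasure k ρ 1).real (KST2023.crossing (3 * (k * n)) (k * n)) = 1) := by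
  intro k hk
  have hk2 : 2 ≤ k := by rcases hk with rfl | rfl <;> norm_num
  refine ⟨fun n => LandmarksA.continuous_real_crossing k _ _,
    fun n => LandmarksA.continuous_real_crossing k _ _, fun n hn ρ => ?_⟩
  exact LandmarksA.real_crossing_top hk2 ρ _ (le_trans (by norm_num) (Nat.mul_le_mul hk2 hn))

end Summit.CriticalPhenomena.CardyFormulaZ2.Cruxes.CriticalPathRSW.FiniteSizeEnvelope

end
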